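import Summits.BirchSwinnertonDyer.Rank1Residual.X11b.Three.LambdaSupplyQuotient
import Literature.NumberTheory.EllipticCurves.ZpExtensionUnramifiedProofs
import Literature.NumberTheory.EllipticCurves.ZpExtensionDihedralProofs
import Literature.NumberTheory.Automorphic.ClassFieldCharacter
import HarnessLib

/-!
# X11b @ `p = 3`, S24-a (λ-supply), part (F-IIa): WEIL'S CHARACTER WITH VALUES IN A FINITE
# EXTENSION OF `ℚ_p`, `ℤ_p`-CHARACTERS KILL PRIME-TO-`p` INERTIA, and small Hecke-side tools

HONEST FRAMING (cell `b2b-bsdres`, run/shared/lean/b2b/bsd-rank1-residual/, verbatim in every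
file): the goal of the cell is to DELETE the COMBINATION-SHAPED residual classes of the
Birch–Swinnerton-Dyer formula for ALL analytic-rank `≤ 1` elliptic curves over `ℚ` — assembled
STRICTLY from published theorems — so that the rank-`≤ 1` remainder becomes exactly the
CONSTRUCTION-SHAPED classes, which are TYPED, NOT attempted. This is not "finishing BSD". Team N8/O2
(X11b at `3`: `3 ‖ N`, `r_an = 1`, `E[3]` irreducible): research route; nothing booked; NO label
changes; O2 stays OPEN. THEOREMS ONLY; no definition, no fact, no `sorry`.

PROVENANCE: sub-target S24 'λ-SUPPLY SPLIT' (OWNERS R7-59 / R8-4 / R8-14 / R8-16), seat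
`b2b-bsdres-x11b3-p7` (gen. 4); census `HOME/b2b-bsdres-x11b3-p7/s24/S24-FEASIBILITY.md` step (F):
the glue between Weil's `ℓ`-adic character (`WeilLAdicCharacterProofs`), the abstract `3`-adic
toolkit of (D)/(F-I) (which needs a COMPLETE, FINITE-DIMENSIONAL coefficient field) and the
rank-one currency `e ∘ ψ` of part (C) (`LambdaSupplyQuotient`, seat p2).

## Contents

* §1 `exists_weilValued`: for an algebraic Hecke character `χ` of `K` and `ι : ℚ̄_p ≃ ℂ` there is a
  finite extension `E/ℚ_p` inside `ℚ̄_p` and a continuous `a : Γ_K →* Eˣ` killing the inertia at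
  every `v ∤ p` where `χ` is unramified and with `a(Frob_v^{arith}) = ι⁻¹(χ(ϖ_v))` there — Weil's
  `R(σ)` (`HasInfinityType.weilValue`), whose values lie in the complete field
  `lAdicValueField` (`rep_mem` + completeness).
* §2 `zpChar_apply_eq_one_of_mem_inertia`: every continuous `Φ : Γ_K →ₜ* ℤ_p` kills the inertia
  groups at `v ∤ p` (saturation `exists_surjective_of_ne_one` + `inertia_le_kerSubgroup_holds`).
* §3 `exists_unitsChar_of_continuous`: a continuous `f : Γ_K →* Eˣ` pushed into `ℚ̄_pˣ` is a
  continuous character `ψ : Γ_K →ₜ* ℚ̄_pˣ` (the currency of `LambdaSupplyQuotient`).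
* §4 Hecke side: `mul_galConj_inv_ideleBaseChange` (`χ · (χ ∘ σ)⁻¹` is trivial on `𝕀_F`),
  `galConj_pow`, `isFiniteOrder_galConj`, `isUnitary_galConj`.

## References

* [Weil1956] A. Weil, *On a certain type of characters of the idèle-class group of an algebraic
  number-field*, §1–§2.
* [Washington1997] L. C. Washington, *Introduction to Cyclotomic Fields*, Prop. 13.2, §13.1.
-/

noncomputable section

open scoped NumberField
open NumberField IsDedekindDomain Field Filter Topology
  Literature.NumberTheory.GaloisRepresentations Literature.NumberTheory.EllipticCurves
  Literature.NumberTheory.Automorphic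

namespace Summit.BirchSwinnertonDyer.Rank1Residual.X11b.Three.LambdaSupply

variable {K : Type} [Field K] [NumberField K] {p : ℕ} [Fact p.Prime]

/-! ### §1. Weil's character with values in the finite extension `E = lAdicValueField` -/

/-- Weil's value `R(σ) = lim_N a_N(σ)` lies in `E = ℚ_p(values)`: the `a_N(σ)` do (`rep_mem`) and
`E` is complete, hence closed. [cite: Weil1956, §2] -/
theorem weilValue_mem {χ : HeckeCharacter K} {T : Finset (HeightOneSpectrum (𝓞 K))}
    {e : HeightOneSpectrum (𝓞 K) → ℕ} {pp qq : InfinitePlace K → ℤ}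
    (hinf : χ.HasInfinityType pp qq) (hmod : HeckeCharacter.IsModulus χ T e)
    (ι : PadicAlgCl p ≃+* ℂ) (σ : absoluteGaloisGroup K) :
    hinf.weilValue hmod ι σ ∈ HeckeCharacter.lAdicValueField χ ι T e :=
  (HeckeCharacter.isComplete_lAdicValueField χ ι T e).isClosed.mem_of_tendsto
    (hinf.tendsto_rep hmod ι σ) (Eventually.of_forall fun N => hinf.rep_mem hmod ι N σ)

/-- **Weil's character with values in a finite extension of `ℚ_p`** (Weil 1956, in the currency
needed by the `3`-adic toolkit): for an algebraic Hecke character `χ` and `ι : ℚ̄_p ≃ ℂ` there are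
a finite extension `E/ℚ_p` inside `ℚ̄_p` and a continuous homomorphism `a : Γ_K →* Eˣ` which kills
the inertia groups at every `v ∤ p` where `χ` is unramified and satisfies
`a(Frob_v^{arith}) = ι⁻¹(χ(ϖ_v))` there. [cite: Weil1956, §1–§2] -/
theorem exists_weilValued (ι : PadicAlgCl p ≃+* ℂ) {χ : HeckeCharacter K} (hχ : χ.IsAlgebraic) :
    ∃ (E : IntermediateField ℚ_[p] (PadicAlgCl p)) (_ : FiniteDimensional ℚ_[p] E)
      (a : absoluteGaloisGroup K →* (E)ˣ), Continuous a ∧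
      ∀ v : HeightOneSpectrum (𝓞 K), ((p : ℕ) : 𝓞 K) ∉ v.asIdeal → χ.IsUnramifiedAt v →
        (∀ 𝔓 ∈ v.primesAbove, ∀ σ ∈ 𝔓.inertia (absoluteGaloisGroup K), a σ = 1) ∧
        ∀ 𝔓 ∈ v.primesAbove, ∀ Φ : absoluteGaloisGroup K, IsArithFrobAt (𝓞 K) Φ 𝔓 →
          (((a Φ : (E)ˣ) : E) : PadicAlgCl p) = ι.symm (χ.valueAtUniformizer v) := by
  obtain ⟨pp, qq, hinf⟩ := χ.isAlgebraic_iff_exists_hasInfinityType.mp hχ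
  obtain ⟨e, hmod⟩ := χ.exists_isModulus_of_ramified
  set T := (HeckeCharacter.finite_ramifiedPlaces_holds χ).toFinset with hT
  set E := HeckeCharacter.lAdicValueField χ ι T e with hE
  haveI hfd : FiniteDimensional ℚ_[p] E := HeckeCharacter.finiteDimensional_lAdicValueField χ ι T e
  have hmem : ∀ σ, hinf.weilValue hmod ι σ ∈ E := weilValue_mem hinf hmod ι
  have hne : ∀ σ, (⟨hinf.weilValue hmod ι σ, hmem σ⟩ : E) ≠ 0 := fun σ h0 =>
    hinf.weilValue_ne_zero hmod ι σ (congrArg Subtype.val h0)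
  -- Weil's `R` as a homomorphism into `Eˣ`
  let a : absoluteGaloisGroup K →* (E)ˣ :=
    { toFun := fun σ => Units.mk0 _ (hne σ)
      map_one' := Units.ext (Subtype.ext (hinf.weilValue_one hmod ι))
      map_mul' := fun σ τ => Units.ext (Subtype.ext (hinf.weilValue_mul hmod ι σ τ)) }
  have ha_coe : ∀ σ, (((a σ : (E)ˣ) : E) : PadicAlgCl p) = hinf.weilValue hmod ι σ := fun σ => rfl
  have hwc : Continuous fun σ => hinf.weilValue hmod ι σ := by
    have := Units.continuous_val.comp (hinf.continuous_weilHom hmod ι)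
    simpa only [Function.comp_def, HeckeCharacter.HasInfinityType.coe_weilHom_apply] using this
  have ha_cont : Continuous a := by
    refine Units.continuous_iff.mpr ⟨?_, ?_⟩
    · exact hwc.subtype_mk fun σ => hmem σ
    · have h1 : (fun σ => (((a σ)⁻¹ : (E)ˣ) : E)) = fun σ =>
          (⟨(hinf.weilValue hmod ι σ)⁻¹, inv_mem (hmem σ)⟩ : E) := by
        funext σ
        apply Subtype.ext
        rw [Units.val_inv_eq_inv_val]
        rfl
      rw [h1]
      exact (hwc.inv₀ fun σ => hinf.weilValue_ne_zero hmod ι σ).subtype_mk _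
  refine ⟨E, hfd, a, ha_cont, fun v hpv hv => ?_⟩
  have hvT : v ∉ T := fun h => ((HeckeCharacter.finite_ramifiedPlaces_holds χ).mem_toFinset.mp h) hv
  refine ⟨fun 𝔓 h𝔓 σ hσ => ?_, fun 𝔓 h𝔓 Φ hΦ => ?_⟩
  · apply Units.ext
    apply Subtype.ext
    exact hinf.weilValue_eq_one_of_mem_inertia hmod ι hvT hpv h𝔓 hσ
  · rw [ha_coe]
    exact hinf.weilValue_frob hmod ι hvT hpv h𝔓 hΦ

/-! ### §2. `ℤ_p`-valued characters kill the inertia at `v ∤ p` -/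

/-- **Every continuous `Φ : Γ_K →ₜ* ℤ_p` kills the inertia groups at the places `v ∤ p`**: write
`Φ = p^k Φ'` with `Φ'` surjective (saturation) and apply "`ℤ_p`-extensions are unramified outside
`p`" to `Φ'`. [cite: Washington1997, Prop. 13.2] -/
theorem zpChar_apply_eq_one_of_mem_inertia (Φ : absoluteGaloisGroup K →ₜ* Multiplicative ℤ_[p])
    {v : HeightOneSpectrum (𝓞 K)} (hv : ((p : ℕ) : 𝓞 K) ∉ v.asIdeal)
    {𝔓 : Ideal (absIntegers (𝓞 K) K)} (h𝔓 : 𝔓 ∈ v.primesAbove) {σ : absoluteGaloisGroup K}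
    (hσ : σ ∈ 𝔓.inertia (absoluteGaloisGroup K)) : Φ σ = 1 := by
  by_cases hΦ : Φ = 1
  · rw [hΦ]; rfl
  obtain ⟨Φ', k, hsurj, hk⟩ := ZpExtension.exists_surjective_of_ne_one Φ hΦ
  have h1 : Φ' σ = 1 := ZpExtension.inertia_le_kerSubgroup_holds (K := K) (p := p) ⟨Φ', hsurj⟩ hv h𝔓 hσ
  apply Multiplicative.toAdd.injective
  rw [hk σ, toAdd_one, h1, toAdd_one, mul_zero]

/-! ### §3. From `Eˣ`-valued homomorphisms to the currency `Γ_K →ₜ* ℚ̄_pˣ` -/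

omit [NumberField K] in
/-- A continuous `f : Γ_K →* Eˣ`, `E ⊆ ℚ̄_p` a subfield, IS a continuous character
`ψ : Γ_K →ₜ* ℚ̄_pˣ` with the same values. [folklore] -/
theorem exists_unitsChar_of_continuous {E : IntermediateField ℚ_[p] (PadicAlgCl p)}
    (f : absoluteGaloisGroup K →* (E)ˣ) (hf : Continuous f) :
    ∃ ψ : absoluteGaloisGroup K →ₜ* (PadicAlgCl p)ˣ,
      ∀ σ, ((ψ σ : (PadicAlgCl p)ˣ) : PadicAlgCl p) = (((f σ : (E)ˣ) : E) : PadicAlgCl p) :=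
  ⟨⟨(Units.map ((algebraMap E (PadicAlgCl p) : E →+* PadicAlgCl p) : E →* PadicAlgCl p)).comp f,
    (Continuous.units_map _ continuous_subtype_val).comp hf⟩, fun _ => rfl⟩

omit [NumberField K] in
/-- Value dictionary: `ψ σ = 1 ↔ f σ = 1` when `ψ` and `f` have the same values. [folklore] -/
theorem unitsChar_eq_one_iff {E : IntermediateField ℚ_[p] (PadicAlgCl p)}
    {ψ : absoluteGaloisGroup K →ₜ* (PadicAlgCl p)ˣ} {f : absoluteGaloisGroup K →* (E)ˣ}
    (h : ∀ σ, ((ψ σ : (PadicAlgCl p)ˣ) : PadicAlgCl p) = (((f σ : (E)ˣ) : E) : PadicAlgCl p))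
    (σ : absoluteGaloisGroup K) : ψ σ = 1 ↔ f σ = 1 := by
  rw [← Units.val_eq_one, h σ, ← Units.val_eq_one, ← OneMemClass.coe_eq_one]

/-! ### §4. Hecke side: the quotient `χ · (χ ∘ σ)⁻¹` on `𝕀_F`, finite order under `galConj` -/

section Hecke

variable {F₀ : Type} [Field F₀] [NumberField F₀] [Algebra F₀ K]

/-- **`χ · (χ ∘ σ)⁻¹` is trivial on the ideles of the base** (`σ • x_K = x_K` for `x ∈ 𝕀_{F₀}`):
the third clause of the λ-supply target, automatic in quotient shape. [folklore] -/
theorem mul_galConj_inv_ideleBaseChange (σ : K ≃ₐ[F₀] K) (χ : HeckeCharacter K)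
    (x : ideleGroup F₀) :
    (χ * (HeckeCharacter.galConj σ χ)⁻¹) (AdeleRing.ideleBaseChange F₀ K x) = 1 := by
  rw [HeckeCharacter.mul_apply, HeckeCharacter.inv_apply, HeckeCharacter.galConj_apply,
    AdeleRing.smul_ideleBaseChange, mul_inv_cancel]

omit [NumberField F₀] in
/-- `galConj σ 1 = 1`. [folklore] -/
theorem galConj_one_right (σ : K ≃ₐ[F₀] K) : HeckeCharacter.galConj σ (1 : HeckeCharacter K) = 1 :=
  HeckeCharacter.ext fun x => by
    rw [HeckeCharacter.galConj_apply, HeckeCharacter.one_apply, HeckeCharacter.one_apply]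

omit [NumberField F₀] in
/-- `galConj` commutes with powers. [folklore] -/
theorem galConj_pow (σ : K ≃ₐ[F₀] K) (χ : HeckeCharacter K) (n : ℕ) :
    HeckeCharacter.galConj σ (χ ^ n) = HeckeCharacter.galConj σ χ ^ n := by
  induction n with
  | zero => rw [pow_zero, pow_zero, galConj_one_right]
  | succ n ih => rw [pow_succ, pow_succ, HeckeCharacter.galConj_mul, ih]

omit [NumberField F₀] in
/-- **`galConj` preserves finite order.** [folklore] -/
theorem isFiniteOrder_galConj (σ : K ≃ₐ[F₀] K) {χ : HeckeCharacter K} (hχ : χ.IsFiniteOrder) :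
    (HeckeCharacter.galConj σ χ).IsFiniteOrder := by
  obtain ⟨n, hn, h1⟩ := hχ.exists_pow_eq_one
  exact isOfFinOrder_iff_pow_eq_one.mpr ⟨n, hn, by rw [← galConj_pow, h1, galConj_one_right]⟩

omit [NumberField F₀] in
/-- **`galConj` preserves unitarity.** [folklore] -/
theorem isUnitary_galConj (σ : K ≃ₐ[F₀] K) {χ : HeckeCharacter K} (hχ : χ.IsUnitary) :
    (HeckeCharacter.galConj σ χ).IsUnitary := fun x => by
  rw [HeckeCharacter.galConj_apply]; exact hχ _

end Hecke

end Summit.BirchSwinnertonDyer.Rank1Residual.X11b.Three.LambdaSupply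

end
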